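import Mathlib
import Summits.NavierStokesRegularity.NavierStokesRegularity.Theorems.TaoLadderRungTwoBreakBlowupRigidityOneTypeIIAncientLimit
import HarnessLib

/-!
# POINT-PICKING and the TYPE-I / TYPE-II DICHOTOMY for exact cascade flows: either the renormalisation is uniformly
  bounded (type I — the input of `eternalLawLimit_of_typeI`), or sup-rescaling around almost-maximisers of
  `‖W̃_n(σ)‖ · dist(σ, ∂I)` yields a NON-TRIVIAL BOUNDED ANCIENT SOLUTION OF THE AUTONOMOUS LATTICE
  (`ancientLimit_of_dominatingSequence`) — for K2(1) `BlowupRigidityOne` (stmt-NavierStokesRegularity-20206) and the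
  type-I stub of K2ᵛ(1) ⟨20420⟩

MODEL lattice ODEs only (Tao 2016 §4 (4.8)/(4.12), §6.4); nothing here is a statement about the Navier–Stokes equations;
NO item is closed (`--supports stmt-NavierStokesRegularity-20206`). Route-independent; general `m`.

* `pointPicking` — ABSTRACT SELECTION: a shell-indexed family `W : ℤ → ℝ → E` that is bounded on every strip
  `σ₀ ≤ σ ≤ σ_b` but unbounded on `σ ≥ σ₀ + 1` admits a DOMINATING SEQUENCE `(n_j, σ_j, R_j)`: `M_j = ‖W_{n_j}(σ_j)‖ → ∞`,
  `R_j → ∞`, window `[σ_j - R_j/M_j, σ_j + 1/M_j] ⊂ [σ₀, ∞)` on which `‖W_n(σ)‖ ≤ 2 M_j` for all shells (almost-maximise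
  `‖W_n(σ)‖ (1 - |σ - σ_C|)` over `ℤ × [σ_C - 1, σ_C + 1]`).
* `typeII_dichotomy` — for an exact flow on `[0,T)` obeying the a-priori regularity (4.5) before `T`: EITHER type I
  (`∃ C, Λ^n (T-t)‖x_n(t)‖ ≤ C`), OR there is `V : ℤ → ℝ → ℝ^m` solving the autonomous lattice law
  `V' = Q(V) + ΛA(V(·-1)) + Λ⁻¹B(V(·+1), V)` for `s < 1` with `‖V_n(s)‖ ≤ 2` (`s ≤ 1`) and `‖V_0(0)‖ = 1`.

HONEST LABEL: the Liouville question «no such ancient solution arises» (which would give type I for robust blow-up, the open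
stub `stub_typeOne` of ⟨20420⟩ / (F1) of ⟨20206⟩'s four-item bundle) is OPEN; no stub, crux or summit is proved.
-/

noncomputable section

-- the summit and its single sub-problem share the name (CONVENTIONS §1)
set_option linter.dupNamespace false

open Set Filter Topology MeasureTheory

namespace Summit.NavierStokesRegularity.NavierStokesRegularity.Theorems

namespace BlowupRigidityOne

open Literature.Analysis.FluidPDE Literature.Analysis.FluidPDE.TaoCascade

section PointPicking

variable {E : Type*} [NormedAddCommGroup E]

/-- **POINT-PICKING (one step).** If `W : ℤ → ℝ → E` is bounded by `S` on the strip `σ₀ ≤ σ ≤ σ_C + 1` and some value at a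
log-time `σ_C ≥ σ₀ + 1` exceeds `C ≥ 4`, then there are `(n*, σ*)` and `R ≥ C/4` with `M* = ‖W_{n*}(σ*)‖ ≥ 3C/4`,
the window `[σ* - R/M*, σ* + 1/M*]` inside `[σ₀, ∞)`, and `‖W_n(σ)‖ ≤ 2 M*` on it for every shell
(almost-maximiser of `‖W_n(σ)‖ · (1 - |σ - σ_C|)`). [folklore (Hamilton–Perelman point-picking; Giga–Kohn rescaling)] -/
theorem pointPicking_step (W : ℤ → ℝ → E) {σ₀ σC C S : ℝ} (hC : 4 ≤ C) (hσC : σ₀ + 1 ≤ σC)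
    (hS : ∀ (n : ℤ) (σ : ℝ), σ₀ ≤ σ → σ ≤ σC + 1 → ‖W n σ‖ ≤ S)
    (hbig : ∃ n : ℤ, C < ‖W n σC‖) :
    ∃ (nS : ℤ) (σS R : ℝ), 3 * C / 4 ≤ ‖W nS σS‖ ∧ C / 4 ≤ R ∧ σ₀ ≤ σS - R / ‖W nS σS‖ ∧
      ∀ (n : ℤ) (σ : ℝ), σS - R / ‖W nS σS‖ ≤ σ → σ ≤ σS + 1 / ‖W nS σS‖ → ‖W n σ‖ ≤ 2 * ‖W nS σS‖ := by
  classical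
  obtain ⟨nC, hnC⟩ := hbig
  -- the weighted values over `ℤ × I`, `I = [σ_C - 1, σ_C + 1]`, weight `d(σ) = 1 - |σ - σ_C|`
  set d : ℝ → ℝ := fun σ => 1 - |σ - σC| with hd
  set G : ℤ × ℝ → ℝ := fun p => ‖W p.1 p.2‖ * d p.2 with hG
  set 𝒢 : Set ℝ := G '' {p : ℤ × ℝ | σC - 1 ≤ p.2 ∧ p.2 ≤ σC + 1} with h𝒢
  have hS0 : 0 ≤ S := (norm_nonneg _).trans (hS nC σC (by linarith) (by linarith))
  have hbdd : BddAbove 𝒢 := by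
    refine ⟨S, ?_⟩
    rintro _ ⟨⟨n, σ⟩, ⟨h1, h2⟩, rfl⟩
    have hdle : d σ ≤ 1 := by simp only [hd]; linarith [abs_nonneg (σ - σC)]
    simp only [hG]
    rcases le_or_gt 0 (d σ) with hd0 | hd0
    · calc ‖W n σ‖ * d σ ≤ S * 1 := mul_le_mul (hS n σ (by linarith) h2) hdle hd0 hS0
        _ = S := mul_one S
    · exact le_trans (mul_nonpos_iff.2 (Or.inl ⟨norm_nonneg _, hd0.le⟩)) hS0
  have hmemC : G (nC, σC) ∈ 𝒢 := ⟨(nC, σC), ⟨by linarith, by linarith⟩, rfl⟩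
  have hGC : G (nC, σC) = ‖W nC σC‖ := by simp [hG, hd]
  have hsupC : C < sSup 𝒢 := lt_of_lt_of_le (hGC ▸ hnC) (le_csSup hbdd hmemC)
  have hsup0 : 0 < sSup 𝒢 := by linarith
  -- an almost-maximiser with factor 3/4
  obtain ⟨_, ⟨⟨nS, σS⟩, ⟨hI1, hI2⟩, rfl⟩, hGS⟩ :=
    exists_lt_of_lt_csSup ⟨_, hmemC⟩ (show 3 / 4 * sSup 𝒢 < sSup 𝒢 by linarith)
  -- notation
  have hGSdef : G (nS, σS) = ‖W nS σS‖ * d σS := rfl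
  rw [hGSdef] at hGS
  have hdS1 : d σS ≤ 1 := by simp only [hd]; linarith [abs_nonneg (σS - σC)]
  have hGpos : 0 < ‖W nS σS‖ * d σS := by linarith
  have hdSpos : 0 < d σS := by
    by_contra h
    push Not at h
    have : ‖W nS σS‖ * d σS ≤ 0 := mul_nonpos_iff.2 (Or.inl ⟨norm_nonneg _, h⟩)
    linarith
  have hMpos : 0 < ‖W nS σS‖ := by
    by_contra h
    push Not at h
    have : ‖W nS σS‖ = 0 := le_antisymm h (norm_nonneg _)
    rw [this, zero_mul] at hGpos
    exact lt_irrefl _ hGpos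
  set M : ℝ := ‖W nS σS‖ with hM
  -- `M ≥ G* > 3/4 sup ≥ 3C/4`
  have hMG : M * d σS ≤ M := by
    calc M * d σS ≤ M * 1 := mul_le_mul_of_nonneg_left hdS1 hMpos.le
      _ = M := mul_one M
  have hM34 : 3 * C / 4 ≤ M := by linarith
  -- the window radius `R := M d*/3`
  refine ⟨nS, σS, M * d σS / 3, hM34, by nlinarith, ?_, ?_⟩
  · -- inside `[σ₀, ∞)`: `σS - d*/3 ≥ σ_C - 1 ≥ σ₀`
    have e : σS - M * d σS / 3 / M = σS - d σS / 3 := by field_simp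
    rw [e]
    have : σS - (σC - 1) ≥ d σS := by
      simp only [hd]
      have := neg_abs_le (σS - σC)
      linarith [abs_sub_comm σS σC, le_abs_self (σC - σS)]
    linarith
  · intro n σ hlo hhi
    have e : σS - M * d σS / 3 / M = σS - d σS / 3 := by field_simp
    rw [e] at hlo
    -- `1/M ≤ d*/3` because `M d* ≥ 3C/4·… ≥ 3`
    have hfw : 1 / M ≤ d σS / 3 := by
      rw [div_le_iff₀ hMpos]
      have : 3 ≤ M * d σS := by linarith
      linarith [this]
    have habs : |σ - σS| ≤ d σS / 3 := by
      rw [abs_le]; constructor <;> linarith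
    -- `σ ∈ I` and `d σ ≥ 2 d*/3`
    have hdσ : 2 * d σS / 3 ≤ d σ := by
      simp only [hd] at habs ⊢
      have := abs_sub_abs_le_abs_sub (σ - σC) (σS - σC)
      rw [show σ - σC - (σS - σC) = σ - σS by ring] at this
      linarith
    have hdσpos : 0 < d σ := by linarith
    have hσI : σC - 1 ≤ σ ∧ σ ≤ σC + 1 := by
      simp only [hd] at hdσpos
      constructor <;> linarith [le_abs_self (σ - σC), neg_abs_le (σ - σC)]
    have hmem : G (n, σ) ∈ 𝒢 := ⟨(n, σ), hσI, rfl⟩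
    have hle : ‖W n σ‖ * d σ ≤ sSup 𝒢 := le_csSup hbdd hmem
    -- `‖W n σ‖ ≤ sSup/dσ < (4/3) M d* / (2 d*/3) = 2M`
    have h1 : ‖W n σ‖ * d σ < 4 / 3 * (M * d σS) := by linarith
    have h2 : ‖W n σ‖ * (2 * d σS / 3) ≤ ‖W n σ‖ * d σ := mul_le_mul_of_nonneg_left hdσ (norm_nonneg _)
    nlinarith

/-- **POINT-PICKING (sequence).** A shell-indexed family `W : ℤ → ℝ → E` bounded on every strip `σ₀ ≤ σ ≤ σ_b` and
UNBOUNDED at log-times `≥ σ₀ + 1` admits a DOMINATING SEQUENCE: `M_j = ‖W_{n_j}(σ_j)‖ → ∞`, `R_j → ∞`, windows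
`[σ_j - R_j/M_j, σ_j + 1/M_j] ⊂ [σ₀, ∞)` on which every shell is bounded by `2 M_j`. [folklore (point-picking)] -/
theorem pointPicking (W : ℤ → ℝ → E) {σ₀ : ℝ}
    (hB : ∀ σb : ℝ, ∃ S : ℝ, ∀ (n : ℤ) (σ : ℝ), σ₀ ≤ σ → σ ≤ σb → ‖W n σ‖ ≤ S)
    (hU : ∀ C : ℝ, ∃ (n : ℤ) (σ : ℝ), σ₀ + 1 ≤ σ ∧ C < ‖W n σ‖) :
    ∃ (nseq : ℕ → ℤ) (σseq R : ℕ → ℝ), Tendsto R atTop atTop ∧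
      Tendsto (fun j => ‖W (nseq j) (σseq j)‖) atTop atTop ∧
      (∀ j : ℕ, σ₀ ≤ σseq j - R j / ‖W (nseq j) (σseq j)‖) ∧
      (∀ (j : ℕ) (n : ℤ) (σ : ℝ), σseq j - R j / ‖W (nseq j) (σseq j)‖ ≤ σ →
        σ ≤ σseq j + 1 / ‖W (nseq j) (σseq j)‖ → ‖W n σ‖ ≤ 2 * ‖W (nseq j) (σseq j)‖) := by
  have step : ∀ j : ℕ, ∃ (nS : ℤ) (σS R : ℝ), 3 * ((j : ℝ) + 4) / 4 ≤ ‖W nS σS‖ ∧ ((j : ℝ) + 4) / 4 ≤ R ∧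
      σ₀ ≤ σS - R / ‖W nS σS‖ ∧
      ∀ (n : ℤ) (σ : ℝ), σS - R / ‖W nS σS‖ ≤ σ → σ ≤ σS + 1 / ‖W nS σS‖ → ‖W n σ‖ ≤ 2 * ‖W nS σS‖ := by
    intro j
    obtain ⟨nC, σC, hσC, hbig⟩ := hU ((j : ℝ) + 4)
    obtain ⟨S, hS⟩ := hB (σC + 1)
    exact pointPicking_step W (by have : (0:ℝ) ≤ j := Nat.cast_nonneg j; linarith) hσC hS ⟨nC, hbig⟩
  choose nseq σseq R h1 h2 h3 h4 using step
  refine ⟨nseq, σseq, R, ?_, ?_, h3, h4⟩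
  · refine tendsto_atTop_mono h2 ?_
    exact (tendsto_atTop_add_const_right _ _ tendsto_natCast_atTop_atTop).atTop_div_const (by norm_num)
  · refine tendsto_atTop_mono h1 ?_
    have : Tendsto (fun j : ℕ => 3 * ((j : ℝ) + 4) / 4) atTop atTop :=
      ((tendsto_atTop_add_const_right _ _ tendsto_natCast_atTop_atTop).const_mul_atTop
        (by norm_num : (0:ℝ) < 3)).atTop_div_const (by norm_num)
    exact this

end PointPicking

section Dichotomy

variable {m : ℕ}

/-- Componentwise bounds `|X_{j,n}(t)| ≤ B` give `‖x_n(t)‖ ≤ √m · B` for the Euclidean shell vector. [folklore] -/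
theorem norm_shellVec_le_sqrt_mul {X : Fin m → ℤ → ℝ → ℝ} {n : ℤ} {t B : ℝ} (hB : 0 ≤ B)
    (h : ∀ j : Fin m, |X j n t| ≤ B) : ‖shellVec X n t‖ ≤ Real.sqrt m * B := by
  rw [EuclideanSpace.norm_eq]
  have hsum : ∑ j : Fin m, ‖shellVec X n t j‖ ^ 2 ≤ (m : ℝ) * B ^ 2 := by
    calc ∑ j : Fin m, ‖shellVec X n t j‖ ^ 2 ≤ ∑ _j : Fin m, B ^ 2 :=
          Finset.sum_le_sum fun j _ => by
            rw [shellVec_apply, Real.norm_eq_abs]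
            exact pow_le_pow_left₀ (abs_nonneg _) (h j) 2
      _ = (m : ℝ) * B ^ 2 := by simp
  calc √(∑ j : Fin m, ‖shellVec X n t j‖ ^ 2) ≤ √((m : ℝ) * B ^ 2) := Real.sqrt_le_sqrt hsum
    _ = Real.sqrt m * B := by rw [Real.sqrt_mul (Nat.cast_nonneg m), Real.sqrt_sq hB]

/-- `Λ^n ≤ 1 + (1+ε₀)^{10n}` for every `n ∈ ℤ` (`Λ = (1+ε₀)^{5/2}`, `ε₀ > 0`): the a-priori weight of (4.5) dominates the
critical weight. [cite: Tao2016AveragedNS, §4 (4.1), (4.5)] -/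
theorem bigLam_zpow_le_one_add_rpow {ε₀ : ℝ} (hε : 0 < ε₀) (n : ℤ) :
    bigLam ε₀ ^ n ≤ 1 + (1 + ε₀) ^ ((10 : ℝ) * n) := by
  have hb : (1 : ℝ) ≤ 1 + ε₀ := by linarith
  have hpos : 0 < (1 + ε₀) ^ ((10 : ℝ) * n) := Real.rpow_pos_of_pos (by linarith) _
  rw [← DSSOneShift.bigLam_zpow_eq_rpow (by linarith) n]
  rcases le_or_gt 0 n with hn | hn
  · have hn' : (0 : ℝ) ≤ n := by exact_mod_cast hn
    have h1 : (1 + ε₀) ^ ((5 : ℝ) * n / 2) ≤ (1 + ε₀) ^ ((10 : ℝ) * n) :=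
      Real.rpow_le_rpow_of_exponent_le hb (by linarith)
    linarith
  · have hn' : (n : ℝ) < 0 := by exact_mod_cast hn
    have h1 : (1 + ε₀) ^ ((5 : ℝ) * n / 2) ≤ 1 :=
      Real.rpow_le_one_of_one_le_of_nonpos hb (by linarith)
    linarith

/-- **THE TYPE-I / TYPE-II DICHOTOMY for exact cascade flows.** Let `X` be an exact flow on `[0,T)` (`T > 0`) obeying
the a-priori regularity (4.5) on every `[0,T']`, `T' < T`, and `W̃` its renormalisation. Then EITHER the flow is TYPE I
(`∃ C, Λ^n (T-t)‖x_n(t)‖ ≤ C` — the input of the type-I extraction `eternalLawLimit_of_typeI`), OR (point-picking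
`pointPicking` + sup-rescaling `ancientLimit_of_dominatingSequence`) there is a NON-TRIVIAL BOUNDED ANCIENT SOLUTION of the
AUTONOMOUS lattice: `V : ℤ → ℝ → ℝ^m` with `V' = Q(V) + ΛA(V(·-1)) + Λ⁻¹B(V(·+1), V)` for `s < 1`, `‖V_n(s)‖ ≤ 2` for
`s ≤ 1`, `‖V_0(0)‖ = 1`.
[cite: Tao2016AveragedNS, §4 Lemma 4.1 (4.5), Thm. 4.2 (statement shape), (4.8), §6.4; KochNadirashviliSereginSverak2009, Thm 1.1 ff.; folklore (point-picking)] -/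
theorem typeII_dichotomy {ε₀ T : ℝ} (hε : 0 < ε₀) (hT : 0 < T)
    {α : Fin m → Fin m → Fin m → ℤ × ℤ × ℤ → ℝ}
    {X : Fin m → ℤ → ℝ → ℝ} (hC1 : ∀ i n, ContDiffOn ℝ 1 (X i n) (Set.Ico 0 T))
    (hmot : ∀ i n t, 0 ≤ t → t < T → derivWithin (X i n) (Set.Ici 0) t = quadTerm ε₀ α X i n t)
    (hapr : ∀ T' : ℝ, 0 < T' → T' < T → ∃ Mb : ℝ, ∀ t : ℝ, 0 ≤ t → t ≤ T' →
      ∀ (i : Fin m) (n : ℤ), (1 + (1 + ε₀) ^ ((10 : ℝ) * n)) * |X i n t| ≤ Mb)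
    {W : ℤ → ℝ → Em m}
    (hW : ∀ n σ, W n σ = (bigLam ε₀ ^ n * Real.exp (-σ)) • shellVec X n (T - Real.exp (-σ))) :
    (∃ C : ℝ, ∀ (n : ℤ) (t : ℝ), 0 ≤ t → t < T → bigLam ε₀ ^ n * (T - t) * ‖shellVec X n t‖ ≤ C) ∨
    ∃ V : ℤ → ℝ → Em m,
      (∀ (n : ℤ) (s : ℝ), s < 1 → HasDerivAt (V n) (tableQ α (V n s) + bigLam ε₀ • tableA α (V (n - 1) s)
        + (bigLam ε₀)⁻¹ • tableB α (V (n + 1) s) (V n s)) s) ∧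
      (∀ (n : ℤ) (s : ℝ), s ≤ 1 → ‖V n s‖ ≤ 2) ∧ ‖V 0 0‖ = 1 := by
  by_cases hI : ∃ C : ℝ, ∀ (n : ℤ) (t : ℝ), 0 ≤ t → t < T → bigLam ε₀ ^ n * (T - t) * ‖shellVec X n t‖ ≤ C
  · exact Or.inl hI
  right
  push Not at hI
  have hΛ : 0 < bigLam ε₀ := bigLam_pos (by linarith)
  -- (B) the renormalisation is bounded on every strip `-log T ≤ σ ≤ σ_b` (a-priori regularity before `T`)
  have hBall : ∀ σb : ℝ, ∃ S : ℝ, ∀ (n : ℤ) (σ : ℝ), -Real.log T ≤ σ → σ ≤ σb → ‖W n σ‖ ≤ S := by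
    intro σb
    rcases lt_or_ge σb (-Real.log T) with hlt | hge
    · exact ⟨0, fun n σ h1 h2 => absurd (h1.trans h2) (not_le.2 hlt)⟩
    · -- a-priori regularity on `[0, T - e^{-σb}/2] ⊃ {T - e^{-σ} : -log T ≤ σ ≤ σb}`
      have heb : Real.exp (-σb) ≤ T := by
        calc Real.exp (-σb) ≤ Real.exp (Real.log T) := Real.exp_le_exp.2 (by linarith)
          _ = T := Real.exp_log hT
      obtain ⟨Mb, hMb⟩ := hapr (T - Real.exp (-σb) / 2) (by linarith [Real.exp_pos (-σb)])
        (by linarith [Real.exp_pos (-σb)])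
      have hMb0 : 0 ≤ |Mb| := abs_nonneg Mb
      refine ⟨T * (Real.sqrt m * |Mb|), fun n σ h1 h2 => ?_⟩
      have heσ : Real.exp (-σ) ≤ T := by
        calc Real.exp (-σ) ≤ Real.exp (Real.log T) := Real.exp_le_exp.2 (by linarith)
          _ = T := Real.exp_log hT
      have ht0 : 0 ≤ T - Real.exp (-σ) := by linarith
      have htT' : T - Real.exp (-σ) ≤ T - Real.exp (-σb) / 2 := by
        have : Real.exp (-σb) ≤ Real.exp (-σ) := Real.exp_le_exp.2 (by linarith)
        linarith [Real.exp_pos (-σb)]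
      -- componentwise: `|X i n t| ≤ Mb / (1 + (1+ε₀)^{10n})`
      have hp : 0 < 1 + (1 + ε₀) ^ ((10 : ℝ) * n) := by positivity
      have hcomp : ∀ j : Fin m, |X j n (T - Real.exp (-σ))| ≤ |Mb| / (1 + (1 + ε₀) ^ ((10 : ℝ) * n)) := by
        intro j
        rw [le_div_iff₀ hp, mul_comm]
        exact (hMb _ ht0 htT' j n).trans (le_abs_self Mb)
      have hx := norm_shellVec_le_sqrt_mul (div_nonneg hMb0 hp.le) hcomp
      rw [renormalisedFlow_norm hε hW]
      have hΛn : bigLam ε₀ ^ n ≤ 1 + (1 + ε₀) ^ ((10 : ℝ) * n) := bigLam_zpow_le_one_add_rpow hε n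
      have hΛn0 : 0 < bigLam ε₀ ^ n := zpow_pos hΛ n
      calc bigLam ε₀ ^ n * Real.exp (-σ) * ‖shellVec X n (T - Real.exp (-σ))‖
          ≤ bigLam ε₀ ^ n * T * (Real.sqrt m * (|Mb| / (1 + (1 + ε₀) ^ ((10 : ℝ) * n)))) := by
            refine mul_le_mul (mul_le_mul_of_nonneg_left heσ hΛn0.le) hx (norm_nonneg _) (by positivity)
        _ = (bigLam ε₀ ^ n / (1 + (1 + ε₀) ^ ((10 : ℝ) * n))) * (T * (Real.sqrt m * |Mb|)) := by
            field_simp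
        _ ≤ 1 * (T * (Real.sqrt m * |Mb|)) := by
            refine mul_le_mul_of_nonneg_right ?_ (by positivity)
            rw [div_le_one hp]; exact hΛn
        _ = T * (Real.sqrt m * |Mb|) := one_mul _
  -- (U) unbounded at late log-times
  set σ₀ : ℝ := -Real.log T + 1 with hσ₀
  have hU : ∀ C : ℝ, ∃ (n : ℤ) (σ : ℝ), σ₀ + 1 ≤ σ ∧ C < ‖W n σ‖ := by
    intro C
    obtain ⟨S₂, hS₂⟩ := hBall (σ₀ + 1)
    obtain ⟨n, t, ht0, htT, hbig⟩ := hI (max C S₂)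
    have hgap : 0 < T - t := by linarith
    refine ⟨n, -Real.log (T - t), ?_, ?_⟩
    · by_contra hlt
      push Not at hlt
      have hlow : -Real.log T ≤ -Real.log (T - t) := by
        have := Real.log_le_log hgap (by linarith : T - t ≤ T)
        linarith
      have h := hS₂ n _ hlow hlt.le
      rw [renormalisedFlow_norm hε hW, neg_neg, Real.exp_log hgap, sub_sub_cancel] at h
      linarith [le_max_right C S₂]
    · rw [renormalisedFlow_norm hε hW, neg_neg, Real.exp_log hgap, sub_sub_cancel]
      linarith [le_max_left C S₂]
  have hB : ∀ σb : ℝ, ∃ S : ℝ, ∀ (n : ℤ) (σ : ℝ), σ₀ ≤ σ → σ ≤ σb → ‖W n σ‖ ≤ S := by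
    intro σb
    obtain ⟨S, hS⟩ := hBall σb
    exact ⟨S, fun n σ h1 h2 => hS n σ (by rw [hσ₀] at h1; linarith) h2⟩
  obtain ⟨nseq, σseq, R, hR, hMinf, hin0, hdom⟩ := pointPicking W hB hU
  have hin : ∀ j : ℕ, Real.exp (-(σseq j - R j / ‖W (nseq j) (σseq j)‖)) < T := by
    intro j
    have h := hin0 j
    calc Real.exp (-(σseq j - R j / ‖W (nseq j) (σseq j)‖)) ≤ Real.exp (-σ₀) := Real.exp_le_exp.2 (by linarith)
      _ < Real.exp (Real.log T) := Real.exp_lt_exp.2 (by rw [hσ₀]; linarith)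
      _ = T := Real.exp_log hT
  exact ancientLimit_of_dominatingSequence hε hC1 hmot hW nseq σseq R hR hMinf hin hdom

end Dichotomy

end BlowupRigidityOne

end Summit.NavierStokesRegularity.NavierStokesRegularity.Theorems

end
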